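import Summits.Ventures.PercRepro.RankLevelSetLevelSixHeavyCellSq27DI2V
import Summits.Ventures.PercRepro.RankLevelSetCoreSixColoopFreeUnion
import Summits.Ventures.PercRepro.RankLevelSetLevelSixCapGlue25
import Summits.Ventures.PercRepro.TriangleCapEightI
import Summits.Ventures.PercRepro.S1TrianglePlusSharp
import Summits.Ventures.PercRepro.S1SeriesLever14
import Summits.Ventures.PercRepro.RankLevelSetCircuitUnionRank
import Summits.Ventures.PercRepro.RankLevelSetDepCountHeavyB
import Summits.Ventures.PercRepro.RankLevelSetFourCircuitNullityFourSharp
import Summits.Ventures.PercRepro.RankLevelSetFiveCircuitNullityFourSharp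
import Summits.Ventures.PercRepro.RankLevelSetLevelSixArithHeavySq23TN1314A
import Summits.Ventures.PercRepro.RankLevelSetLevelSixArithHeavySq23TN1516A

/-!
# PercRepro — THE 23 ROW, CORANKS 13 … 16: THE HONEST EVERY-CORE CELLS (THE H-TERM FACTOR) (p8 g11, S3)

`proofs/SUBCLAIM-S3-p8.md` §3y. `(phiK p 6)·#U ≤ #Y` on every `e`-free core of rank `p ≥ 23`, corank `13`, on the cell `sq27di2v` with the `H`-term factor `p + 13 − 18` (`ν₁ = 10`, `j = 1`, `j′ = 1`, `|UG| ≤ 22`, `|UH| ≤ 18`, `Kn/Kd = 14666/1000`; `D = C(p + 6, 6)`; caps `s₃ ≤ 34`, `s₄ ≤ 372`, `s₅ ≤ 3893`, `s₆ ≤ 18564`, `s₇ ≤ 50388` at `n₀ = 36`; parts RankLevelSetLevelSixArithHeavySq23TN13A). Axioms: standard.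

`proofs/SUBCLAIM-S3-p8.md` §3y. `(phiK p 6)·#U ≤ #Y` on every `e`-free core of rank `p ≥ 23`, corank `14`, on the cell `sq27di2v` with the `H`-term factor `p + 14 − 19` (`ν₁ = 11`, `j = 1`, `j′ = 1`, `|UG| ≤ 23`, `|UH| ≤ 19`, `Kn/Kd = 10477/1000`; `D = C(p + 6, 6)`; caps `s₃ ≤ 40`, `s₄ ≤ 471`, `s₅ ≤ 5283`, `s₆ ≤ 27132`, `s₇ ≤ 77520` at `n₀ = 37`; parts RankLevelSetLevelSixArithHeavySq23TN14A). Axioms: standard.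

`proofs/SUBCLAIM-S3-p8.md` §3y. `(phiK p 6)·#U ≤ #Y` on every `e`-free core of rank `p ≥ 23`, corank `15`, on the cell `sq27di2v` with the `H`-term factor `p + 15 − 19` (`ν₁ = 11`, `j = 1`, `j′ = 1`, `|UG| ≤ 25`, `|UH| ≤ 19`, `Kn/Kd = 7747/1000`; `D = C(p + 6, 6)`; caps `s₃ ≤ 47`, `s₄ ≤ 588`, `s₅ ≤ 7044`, `s₆ ≤ 38760`, `s₇ ≤ 116280` at `n₀ = 38`; parts RankLevelSetLevelSixArithHeavySq23TN15A). Axioms: standard.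

`proofs/SUBCLAIM-S3-p8.md` §3y. `(phiK p 6)·#U ≤ #Y` on every `e`-free core of rank `p ≥ 23`, corank `16`, on the cell `sq27di2v` with the `H`-term factor `p + 16 − 19` (`ν₁ = 12`, `j = 1`, `j′ = 1`, `|UG| ≤ 26`, `|UH| ≤ 19`, `Kn/Kd = 5905/1000`; `D = C(p + 6, 6)`; caps `s₃ ≤ 54`, `s₄ ≤ 726`, `s₅ ≤ 9245`, `s₆ ≤ 54264`, `s₇ ≤ 170544` at `n₀ = 39`; parts RankLevelSetLevelSixArithHeavySq23TN16A). Axioms: standard.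
-/

open scoped Matroid

namespace PercRepro

namespace ThmN

open Set

variable {α : Type}

-- ===== RankLevelSetLevelSixT23Every13 =====


/-- **THE HONEST EVERY-CORE CELL `(p ≥ 23, 13)` of the `23` row at corank `13`** (level 0, `phiK p 6`, `D = C(p + 6, 6)`). -/
theorem c025_core_six_t23_every13 (M : Matroid α) [M.Finite] (p : ℕ) (hp : 23 ≤ p)
    (hR : M.eRank = (p : ℕ∞)) (hn : M.E.ncard = p + 13)
    (hfree : ∀ e ∈ M.E, ∃ A ⊆ M.E \ {e}, e ∉ M.closure A ∧ e ∉ M.closure ((M.E \ {e}) \ A)) :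
    RLS M p 6 := by
  classical
  have hd : M.E.encard = M.eRank + (13 : ℕ) := by
    rw [hR, ← M.ground_finite.cast_ncard_eq, hn]
    push_cast
    ring
  have hL : ∀ e ∈ M.E, ¬ M.IsLoop e := not_isLoop_of_free M hfree
  have hs : ∀ e ∈ M.E, ∀ f ∈ M.E, e ≠ f → M.eRk {e, f} = 2 := by
    intro e he f hf hef
    have h2 : (2 : ℕ∞) ≤ M.eRk {e, f} :=
      two_le_eRk_of_two_le_ncard_of_free M hfree (pair_subset he hf) (by rw [ncard_pair hef])
    have h3 : M.eRk {e, f} ≤ 2 := by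
      have := M.eRk_le_encard {e, f}
      rwa [encard_pair hef] at this
    exact le_antisymm h3 h2
  have hc : ∀ X ⊆ M.E, M.eRk X ≤ ((6 - 2 : ℕ) : ℕ∞) → (X.ncard : ℕ∞) ≤ M.eRk X + cnull 4 :=
    fun X hX hr => nullity_cap_core M hfree 4 (le_refl 4) X hX (by simpa using hr)
  have hc6 : cnull 4 + 1 ≤ 10 := by simp [cnull]
  have hcj : ∀ X ⊆ M.E, M.eRk X ≤ ((6 - 1 - 1 : ℕ) : ℕ∞) → (X.ncard : ℕ∞) ≤ M.eRk X + cnull (4) :=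
    fun X hX hr => nullity_cap_core M hfree 4 (by omega) X hX
      (by rwa [show (6 - 1 - 1 : ℕ) = 4 by omega] at hr)
  have hcj' : ∀ X ⊆ M.E, M.eRk X ≤ ((6 - 1 - 1 - 1 : ℕ) : ℕ∞) → (X.ncard : ℕ∞) ≤ M.eRk X + cnull (3) :=
    fun X hX hr => nullity_cap_core M hfree 3 (by omega) X hX
      (by rwa [show (6 - 1 - 1 - 1 : ℕ) = 3 by omega] at hr)
  have hUG : (Matroid.UG M 6 10).ncard ≤ 22 := by
    have := Matroid.ncard_UG_le (M := M) (q := 6) (ν₁ := 10) (j := 1) (by norm_num) hd hc hc6 hcj (by norm_num [cnull])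
    simpa using this
  have hcap : ∀ X ⊆ M.E, ∀ k : ℕ, M.eRk X ≤ k → X.ncard ≤ k + 13 := by
    intro X hX k hr
    have h1 := Matroid.encard_le_eRk_add_of_encard_eq hX hd
    have h2 : X.encard ≤ (k : ℕ∞) + ((13 : ℕ) : ℕ∞) := h1.trans (add_le_add_left hr _)
    have hfin : X.Finite := M.ground_finite.subset hX
    rw [← hfin.cast_ncard_eq] at h2; exact_mod_cast h2
  have hflat' : ∀ X ⊆ M.E, M.eRk X ≤ ((6 - 1 : ℕ) : ℕ∞) → X.ncard ≤ 18 :=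
    fun X hX hr => hcap X hX 5 (by simpa using hr)
  have hUH : (Matroid.UH M 6 10).ncard ≤ 18 :=
    Matroid.ncard_UH_le_of_unique (M := M) (q := 6) (ν₁ := 10) hd hc (by norm_num [cnull]) hflat'
  have hΦ : phiK p 6 ≤ (2 : ℚ) ^ (p + 6) / (((p + 6).choose 6 : ℕ) : ℚ) := phiK_le_two_pow_div_six p
  rw [RLS_iff]
  exact c025_core_six_heavy_cell_sq27di2v M p 13 10 22 18 0 14666 1000 19 3893 372 34 18564 50388
      ((p + 6).choose 6) (Nat.choose_pos (by omega)) (phiK p 6) hΦ (by norm_num) (by omega)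
      (by norm_num) hUG hUH (by omega) (Or.inl (by norm_num)) (by norm_num) (by norm_num) (by norm_num)
      ((TriangleCap.core_ncard_triangles_le_cq3 M hfree hd).trans (by decide))
      ((ncard_fourCircuits_le_avgChain14 13 M hfree hd).trans (by decide))
      ((S1.ncard_fiveCircuits_le_avgChain5c 13 M hfree hd).trans (by decide))
      ((Matroid.ncard_circuits_le_choose_of_encard M hd 5).trans (by decide))
      ((Matroid.ncard_circuits_le_choose_of_encard M hd 6).trans (by decide))
      (Or.inl (tail_six_heavy_sq23TN13_13 p hp)) hR hn hfree (level_six_poly_heavy_sq23TN13_13 p hp)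

-- ===== RankLevelSetLevelSixT23Every14 =====


/-- **THE HONEST EVERY-CORE CELL `(p ≥ 23, 14)` of the `23` row at corank `14`** (level 0, `phiK p 6`, `D = C(p + 6, 6)`). -/
theorem c025_core_six_t23_every14 (M : Matroid α) [M.Finite] (p : ℕ) (hp : 23 ≤ p)
    (hR : M.eRank = (p : ℕ∞)) (hn : M.E.ncard = p + 14)
    (hfree : ∀ e ∈ M.E, ∃ A ⊆ M.E \ {e}, e ∉ M.closure A ∧ e ∉ M.closure ((M.E \ {e}) \ A)) :
    RLS M p 6 := by
  classical
  have hd : M.E.encard = M.eRank + (14 : ℕ) := by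
    rw [hR, ← M.ground_finite.cast_ncard_eq, hn]
    push_cast
    ring
  have hL : ∀ e ∈ M.E, ¬ M.IsLoop e := not_isLoop_of_free M hfree
  have hs : ∀ e ∈ M.E, ∀ f ∈ M.E, e ≠ f → M.eRk {e, f} = 2 := by
    intro e he f hf hef
    have h2 : (2 : ℕ∞) ≤ M.eRk {e, f} :=
      two_le_eRk_of_two_le_ncard_of_free M hfree (pair_subset he hf) (by rw [ncard_pair hef])
    have h3 : M.eRk {e, f} ≤ 2 := by
      have := M.eRk_le_encard {e, f}
      rwa [encard_pair hef] at this
    exact le_antisymm h3 h2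
  have hc : ∀ X ⊆ M.E, M.eRk X ≤ ((6 - 2 : ℕ) : ℕ∞) → (X.ncard : ℕ∞) ≤ M.eRk X + cnull 4 :=
    fun X hX hr => nullity_cap_core M hfree 4 (le_refl 4) X hX (by simpa using hr)
  have hc6 : cnull 4 + 1 ≤ 11 := by simp [cnull]
  have hcj : ∀ X ⊆ M.E, M.eRk X ≤ ((6 - 1 - 1 : ℕ) : ℕ∞) → (X.ncard : ℕ∞) ≤ M.eRk X + cnull (4) :=
    fun X hX hr => nullity_cap_core M hfree 4 (by omega) X hX
      (by rwa [show (6 - 1 - 1 : ℕ) = 4 by omega] at hr)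
  have hcj' : ∀ X ⊆ M.E, M.eRk X ≤ ((6 - 1 - 1 - 1 : ℕ) : ℕ∞) → (X.ncard : ℕ∞) ≤ M.eRk X + cnull (3) :=
    fun X hX hr => nullity_cap_core M hfree 3 (by omega) X hX
      (by rwa [show (6 - 1 - 1 - 1 : ℕ) = 3 by omega] at hr)
  have hUG : (Matroid.UG M 6 11).ncard ≤ 23 := by
    have := Matroid.ncard_UG_le (M := M) (q := 6) (ν₁ := 11) (j := 1) (by norm_num) hd hc hc6 hcj (by norm_num [cnull])
    simpa using this
  have hcap : ∀ X ⊆ M.E, ∀ k : ℕ, M.eRk X ≤ k → X.ncard ≤ k + 14 := by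
    intro X hX k hr
    have h1 := Matroid.encard_le_eRk_add_of_encard_eq hX hd
    have h2 : X.encard ≤ (k : ℕ∞) + ((14 : ℕ) : ℕ∞) := h1.trans (add_le_add_left hr _)
    have hfin : X.Finite := M.ground_finite.subset hX
    rw [← hfin.cast_ncard_eq] at h2; exact_mod_cast h2
  have hflat' : ∀ X ⊆ M.E, M.eRk X ≤ ((6 - 1 : ℕ) : ℕ∞) → X.ncard ≤ 19 :=
    fun X hX hr => hcap X hX 5 (by simpa using hr)
  have hUH : (Matroid.UH M 6 11).ncard ≤ 19 :=
    Matroid.ncard_UH_le_of_unique (M := M) (q := 6) (ν₁ := 11) hd hc (by norm_num [cnull]) hflat'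
  have hΦ : phiK p 6 ≤ (2 : ℚ) ^ (p + 6) / (((p + 6).choose 6 : ℕ) : ℚ) := phiK_le_two_pow_div_six p
  rw [RLS_iff]
  exact c025_core_six_heavy_cell_sq27di2v M p 14 11 23 19 0 10477 1000 20 5283 471 40 27132 77520
      ((p + 6).choose 6) (Nat.choose_pos (by omega)) (phiK p 6) hΦ (by norm_num) (by omega)
      (by norm_num) hUG hUH (by omega) (Or.inl (by norm_num)) (by norm_num) (by norm_num) (by norm_num)
      ((TriangleCap.core_ncard_triangles_le_cq3 M hfree hd).trans (by decide))
      ((ncard_fourCircuits_le_avgChain14 14 M hfree hd).trans (by decide))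
      ((S1.ncard_fiveCircuits_le_avgChain5c 14 M hfree hd).trans (by decide))
      ((Matroid.ncard_circuits_le_choose_of_encard M hd 5).trans (by decide))
      ((Matroid.ncard_circuits_le_choose_of_encard M hd 6).trans (by decide))
      (Or.inl (tail_six_heavy_sq23TN14_14 p hp)) hR hn hfree (level_six_poly_heavy_sq23TN14_14 p hp)

-- ===== RankLevelSetLevelSixT23Every15 =====


/-- **THE HONEST EVERY-CORE CELL `(p ≥ 23, 15)` of the `23` row at corank `15`** (level 0, `phiK p 6`, `D = C(p + 6, 6)`). -/
theorem c025_core_six_t23_every15 (M : Matroid α) [M.Finite] (p : ℕ) (hp : 23 ≤ p)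
    (hR : M.eRank = (p : ℕ∞)) (hn : M.E.ncard = p + 15)
    (hfree : ∀ e ∈ M.E, ∃ A ⊆ M.E \ {e}, e ∉ M.closure A ∧ e ∉ M.closure ((M.E \ {e}) \ A)) :
    RLS M p 6 := by
  classical
  have hd : M.E.encard = M.eRank + (15 : ℕ) := by
    rw [hR, ← M.ground_finite.cast_ncard_eq, hn]
    push_cast
    ring
  have hL : ∀ e ∈ M.E, ¬ M.IsLoop e := not_isLoop_of_free M hfree
  have hs : ∀ e ∈ M.E, ∀ f ∈ M.E, e ≠ f → M.eRk {e, f} = 2 := by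
    intro e he f hf hef
    have h2 : (2 : ℕ∞) ≤ M.eRk {e, f} :=
      two_le_eRk_of_two_le_ncard_of_free M hfree (pair_subset he hf) (by rw [ncard_pair hef])
    have h3 : M.eRk {e, f} ≤ 2 := by
      have := M.eRk_le_encard {e, f}
      rwa [encard_pair hef] at this
    exact le_antisymm h3 h2
  have hc : ∀ X ⊆ M.E, M.eRk X ≤ ((6 - 2 : ℕ) : ℕ∞) → (X.ncard : ℕ∞) ≤ M.eRk X + cnull 4 :=
    fun X hX hr => nullity_cap_core M hfree 4 (le_refl 4) X hX (by simpa using hr)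
  have hc6 : cnull 4 + 1 ≤ 11 := by simp [cnull]
  have hcj : ∀ X ⊆ M.E, M.eRk X ≤ ((6 - 1 - 1 : ℕ) : ℕ∞) → (X.ncard : ℕ∞) ≤ M.eRk X + cnull (4) :=
    fun X hX hr => nullity_cap_core M hfree 4 (by omega) X hX
      (by rwa [show (6 - 1 - 1 : ℕ) = 4 by omega] at hr)
  have hcj' : ∀ X ⊆ M.E, M.eRk X ≤ ((6 - 1 - 1 - 1 : ℕ) : ℕ∞) → (X.ncard : ℕ∞) ≤ M.eRk X + cnull (3) :=
    fun X hX hr => nullity_cap_core M hfree 3 (by omega) X hX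
      (by rwa [show (6 - 1 - 1 - 1 : ℕ) = 3 by omega] at hr)
  have hUG : (Matroid.UG M 6 11).ncard ≤ 25 := by
    have := Matroid.ncard_UG_le (M := M) (q := 6) (ν₁ := 11) (j := 1) (by norm_num) hd hc hc6 hcj (by norm_num [cnull])
    simpa using this
  have hcap : ∀ X ⊆ M.E, ∀ k : ℕ, M.eRk X ≤ k → X.ncard ≤ k + 15 := by
    intro X hX k hr
    have h1 := Matroid.encard_le_eRk_add_of_encard_eq hX hd
    have h2 : X.encard ≤ (k : ℕ∞) + ((15 : ℕ) : ℕ∞) := h1.trans (add_le_add_left hr _)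
    have hfin : X.Finite := M.ground_finite.subset hX
    rw [← hfin.cast_ncard_eq] at h2; exact_mod_cast h2
  have hflat' : ∀ X ⊆ M.E, M.eRk X ≤ ((6 - 1 : ℕ) : ℕ∞) → X.ncard ≤ 19 :=
    fun X hX hr => ncard_le_nineteen_of_eRk_le_five_of_free M hfree hX (by simpa using hr)
  have hUH : (Matroid.UH M 6 11).ncard ≤ 19 :=
    Matroid.ncard_UH_le_of_unique (M := M) (q := 6) (ν₁ := 11) hd hc (by norm_num [cnull]) hflat'
  have hΦ : phiK p 6 ≤ (2 : ℚ) ^ (p + 6) / (((p + 6).choose 6 : ℕ) : ℚ) := phiK_le_two_pow_div_six p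
  rw [RLS_iff]
  exact c025_core_six_heavy_cell_sq27di2v M p 15 11 25 19 0 7747 1000 21 7044 588 47 38760 116280
      ((p + 6).choose 6) (Nat.choose_pos (by omega)) (phiK p 6) hΦ (by norm_num) (by omega)
      (by norm_num) hUG hUH (by omega) (Or.inl (by norm_num)) (by norm_num) (by norm_num) (by norm_num)
      ((TriangleCap.core_ncard_triangles_le_cq3 M hfree hd).trans (by decide))
      ((ncard_fourCircuits_le_avgChain14 15 M hfree hd).trans (by decide))
      ((S1.ncard_fiveCircuits_le_avgChain5c 15 M hfree hd).trans (by decide))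
      ((Matroid.ncard_circuits_le_choose_of_encard M hd 5).trans (by decide))
      ((Matroid.ncard_circuits_le_choose_of_encard M hd 6).trans (by decide))
      (Or.inl (tail_six_heavy_sq23TN15_15 p hp)) hR hn hfree (level_six_poly_heavy_sq23TN15_15 p hp)

-- ===== RankLevelSetLevelSixT23Every16 =====


/-- **THE HONEST EVERY-CORE CELL `(p ≥ 23, 16)` of the `23` row at corank `16`** (level 0, `phiK p 6`, `D = C(p + 6, 6)`). -/
theorem c025_core_six_t23_every16 (M : Matroid α) [M.Finite] (p : ℕ) (hp : 23 ≤ p)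
    (hR : M.eRank = (p : ℕ∞)) (hn : M.E.ncard = p + 16)
    (hfree : ∀ e ∈ M.E, ∃ A ⊆ M.E \ {e}, e ∉ M.closure A ∧ e ∉ M.closure ((M.E \ {e}) \ A)) :
    RLS M p 6 := by
  classical
  have hd : M.E.encard = M.eRank + (16 : ℕ) := by
    rw [hR, ← M.ground_finite.cast_ncard_eq, hn]
    push_cast
    ring
  have hL : ∀ e ∈ M.E, ¬ M.IsLoop e := not_isLoop_of_free M hfree
  have hs : ∀ e ∈ M.E, ∀ f ∈ M.E, e ≠ f → M.eRk {e, f} = 2 := by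
    intro e he f hf hef
    have h2 : (2 : ℕ∞) ≤ M.eRk {e, f} :=
      two_le_eRk_of_two_le_ncard_of_free M hfree (pair_subset he hf) (by rw [ncard_pair hef])
    have h3 : M.eRk {e, f} ≤ 2 := by
      have := M.eRk_le_encard {e, f}
      rwa [encard_pair hef] at this
    exact le_antisymm h3 h2
  have hc : ∀ X ⊆ M.E, M.eRk X ≤ ((6 - 2 : ℕ) : ℕ∞) → (X.ncard : ℕ∞) ≤ M.eRk X + cnull 4 :=
    fun X hX hr => nullity_cap_core M hfree 4 (le_refl 4) X hX (by simpa using hr)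
  have hc6 : cnull 4 + 1 ≤ 12 := by simp [cnull]
  have hcj : ∀ X ⊆ M.E, M.eRk X ≤ ((6 - 1 - 1 : ℕ) : ℕ∞) → (X.ncard : ℕ∞) ≤ M.eRk X + cnull (4) :=
    fun X hX hr => nullity_cap_core M hfree 4 (by omega) X hX
      (by rwa [show (6 - 1 - 1 : ℕ) = 4 by omega] at hr)
  have hcj' : ∀ X ⊆ M.E, M.eRk X ≤ ((6 - 1 - 1 - 1 : ℕ) : ℕ∞) → (X.ncard : ℕ∞) ≤ M.eRk X + cnull (3) :=
    fun X hX hr => nullity_cap_core M hfree 3 (by omega) X hX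
      (by rwa [show (6 - 1 - 1 - 1 : ℕ) = 3 by omega] at hr)
  have hUG : (Matroid.UG M 6 12).ncard ≤ 26 := by
    have := Matroid.ncard_UG_le (M := M) (q := 6) (ν₁ := 12) (j := 1) (by norm_num) hd hc hc6 hcj (by norm_num [cnull])
    simpa using this
  have hcap : ∀ X ⊆ M.E, ∀ k : ℕ, M.eRk X ≤ k → X.ncard ≤ k + 16 := by
    intro X hX k hr
    have h1 := Matroid.encard_le_eRk_add_of_encard_eq hX hd
    have h2 : X.encard ≤ (k : ℕ∞) + ((16 : ℕ) : ℕ∞) := h1.trans (add_le_add_left hr _)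
    have hfin : X.Finite := M.ground_finite.subset hX
    rw [← hfin.cast_ncard_eq] at h2; exact_mod_cast h2
  have hflat' : ∀ X ⊆ M.E, M.eRk X ≤ ((6 - 1 : ℕ) : ℕ∞) → X.ncard ≤ 19 :=
    fun X hX hr => ncard_le_nineteen_of_eRk_le_five_of_free M hfree hX (by simpa using hr)
  have hUH : (Matroid.UH M 6 12).ncard ≤ 19 :=
    Matroid.ncard_UH_le_of_unique (M := M) (q := 6) (ν₁ := 12) hd hc (by norm_num [cnull]) hflat'
  have hΦ : phiK p 6 ≤ (2 : ℚ) ^ (p + 6) / (((p + 6).choose 6 : ℕ) : ℚ) := phiK_le_two_pow_div_six p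
  rw [RLS_iff]
  exact c025_core_six_heavy_cell_sq27di2v M p 16 12 26 19 0 5905 1000 22 9245 726 54 54264 170544
      ((p + 6).choose 6) (Nat.choose_pos (by omega)) (phiK p 6) hΦ (by norm_num) (by omega)
      (by norm_num) hUG hUH (by omega) (Or.inl (by norm_num)) (by norm_num) (by norm_num) (by norm_num)
      ((TriangleCap.core_ncard_triangles_le_cq3 M hfree hd).trans (by decide))
      ((ncard_fourCircuits_le_avgChain14 16 M hfree hd).trans (by decide))
      ((S1.ncard_fiveCircuits_le_avgChain5c 16 M hfree hd).trans (by decide))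
      ((Matroid.ncard_circuits_le_choose_of_encard M hd 5).trans (by decide))
      ((Matroid.ncard_circuits_le_choose_of_encard M hd 6).trans (by decide))
      (Or.inl (tail_six_heavy_sq23TN16_16 p hp)) hR hn hfree (level_six_poly_heavy_sq23TN16_16 p hp)

end ThmN

end PercRepro
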